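import Summits.ABC.IUTFork.Cor312ThetaLocalGeContentHull
import Summits.ABC.IUTFork.Cor312PilotIdelesPadic
import Literature.IUT.LogVolume.TensorPacketStepV
import HarnessLib

/-!
# [IUTchIII] Corollary 3.12 — the `hwit` discharger of the per-packet REVERSE inequality for SHARP settings over any `p`-adic
# presentation: exact-content witnesses in the union of the possible images, through (Ind1) (generic template)

PROOF-ONLY file (D-0012; no definitions, no `Prop` facts) of the abc-iut cell (R2 S-chain seat abc-iut-s2-p9, gen 0). TAKES NO SIDE on
[IUTchIII] Cor. 3.12. Generic (any setting `P` over any `p`-adic presentation `Pr`, any Θ-idele family `t`) form of this seat's M-level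
`exists_mem_sUnion_possibleImages_exact_content(_of_ideles)` (`Cor312ThetaSideEqualM(AnyIdeles)`, p448956 / p450039), so that the F- and
K-level lines (abc-iut-s2-p6 / s2-p7 / s2-p10) instantiate `Cor312Vol.sum_content_hull_le_thetaLocal_untopD` (p448133) in one line each:

* **`exists_mem_sUnion_possibleImages_exact_content_of_sharpBox`** — if the (Ind3)-region of `P` at `(i+1, v_ℚ)` IS the product of the
  last-slot sharp boxes `e⁻¹(Π_{v⃗} ι_{i+1}(t_{i,v⃗(last)})·(R_I)^∼)` of the presentation (`hR3`; abc-iut-s2-p8 `PadicPresentation.sharpBox`),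
  then every summand `v⃗` carries, in the union of the possible images, a vector of content EXACTLY `p^{m(v⃗)}` for any exact content exponent
  `m(v⃗)` of the slot union `⋃_a ι_a(t_{i,v⃗ a})·(R_I)^∼` — the exact-content vector lies in some slot `a`, i.e. in the (Ind1)-image
  `perm_σ(sharpBox_{v⃗∘σ})`, `σ = (last a)` (abc-iut-S8 `image_permAlgEquiv_iota_smul_normalizedPacket`), reached by this seat's
  `exists_mem_sUnion_possibleImages_comparison_eq_permX`.

[cite: Mochizuki2012, IUTchIII Thm. 3.11 (i) (Ind1) p. 154] [cite: DupuyHilado2025, §3.7, §4.7, §4.12]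
[claim: Mochizuki2012, status: disputed] for the quoted constructions. HONEST FRAMING: a property of the TYPED objects; typed ≠ proved.
-/

noncomputable section

open Set Function
open scoped Pointwise

namespace Summit.ABC.IUTFork.Cor312Vol

open Thm311 Cor312 Literature.IUT.LogThetaLattice Literature.IUT.LogVolume

section Setting

open PadicPresentation

variable {T : ThetaIndex} {S : Situation T} {P : Cor312.Setting S} {vQ : T.VQ} {p : ℕ} [hp : Fact p.Prime]
  (Pr : PadicPresentation S.L vQ p)

/-- **Exact-content witnesses for a SHARP (Ind3)-region** `e⁻¹(Π_{v⃗} sharpBox_{v⃗})`: for every summand `v⃗` at `(i+1, v_ℚ)` and every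
exact content exponent `m` of the slot union `⋃_a ι_a(t_{i,v⃗ a})·(R_I)^∼`, some point of the union of the possible images has
`v⃗`-component in `p^m·log_p(R_{v⃗}^×) ∖ p^{m+1}·log_p(R_{v⃗}^×)` ((Ind1) transport of a last-slot box; `0` lies in every box).
[cite: Mochizuki2012, IUTchIII Thm. 3.11 (i) (Ind1) p. 154] [cite: DupuyHilado2025, §4.7, §4.12] -/
theorem exists_mem_sUnion_possibleImages_exact_content_of_sharpBox (t : Fin T.lstar → ∀ x : T.Fibre vQ, Pr.k x)
    (i : Fin T.lstar)
    (hR3 : P.thetaRegion3 (Cor312.Setting.labelSucc i) vQ =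
      Pr.comparison (Cor312.Setting.labelSucc i) ⁻¹' Set.pi univ (Pr.sharpBox t (Cor312.Setting.labelSucc i)))
    (e : T.Caps (Cor312.Setting.labelSucc i) → T.Fibre vQ) (m : ℤ)
    (hm0 : (⋃ a, iota p (Pr.kk e) a (t i (e a)) • (normalizedPacket p (Pr.kk e) : Set (Pr.X e))) ⊆
      ((p : ℚ_[p]) ^ m) • (logPacket p (Pr.kk e) : Set (Pr.X e)))
    (hm1 : ¬ (⋃ a, iota p (Pr.kk e) a (t i (e a)) • (normalizedPacket p (Pr.kk e) : Set (Pr.X e))) ⊆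
      ((p : ℚ_[p]) ^ (m + 1)) • (logPacket p (Pr.kk e) : Set (Pr.X e))) :
    ∃ x ∈ ⋃₀ P.possibleImages (Cor312.Setting.labelSucc i) vQ,
      Pr.comparison (Cor312.Setting.labelSucc i) x e ∈ ((p : ℚ_[p]) ^ m) • (logPacket p (Pr.kk e) : Set (Pr.X e)) ∧
        Pr.comparison (Cor312.Setting.labelSucc i) x e ∉ ((p : ℚ_[p]) ^ (m + 1)) • (logPacket p (Pr.kk e) : Set (Pr.X e)) := by
  classical
  haveI : Nonempty (T.Caps (Cor312.Setting.labelSucc i)) := ⟨0⟩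
  obtain ⟨y, hyU, hy1⟩ := Set.not_subset.mp hm1
  have hy0 := hm0 hyU
  obtain ⟨a, hya⟩ := Set.mem_iUnion.mp hyU
  obtain ⟨σ, rfl⟩ : ∃ σ : Equiv.Perm (T.Caps (Cor312.Setting.labelSucc i)), σ (Fin.last _) = a :=
    ⟨Equiv.swap (Fin.last _) a, Equiv.swap_apply_left _ _⟩
  -- the slot-`σ(last)` box at `v⃗` is `perm_σ` of the last-slot box at `v⃗∘σ`
  have hbox : ⇑(permAlgEquiv p (Pr.kk e) σ) '' Pr.sharpBox t (Cor312.Setting.labelSucc i) (e ∘ σ) =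
      iota p (Pr.kk e) (σ (Fin.last _)) (t i (e (σ (Fin.last _)))) • (normalizedPacket p (Pr.kk e) : Set (Pr.X e)) := by
    rw [PadicPresentation.sharpBox, PadicPresentation.labelIdele_labelSucc]
    exact image_permAlgEquiv_iota_smul_normalizedPacket p (Pr.kk e) σ (Fin.last _) _
  rw [← hbox] at hya
  obtain ⟨z, hz, hzy⟩ := hya
  have hB0 : ∀ e', (0 : Pr.X e') ∈ Pr.sharpBox t (Cor312.Setting.labelSucc i) e' :=
    fun e' => Set.mem_smul_set.mpr ⟨0, Subring.zero_mem _, smul_zero _⟩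
  obtain ⟨x, hxU, hx⟩ := exists_mem_sUnion_possibleImages_comparison_eq_permX (P := P) Pr (Cor312.Setting.labelSucc i)
    (Pr.sharpBox t (Cor312.Setting.labelSucc i)) (subset_of_eq hR3.symm) hB0 e σ hz
  refine ⟨x, hxU, ?_⟩
  have hxy : Pr.comparison (Cor312.Setting.labelSucc i) x e = y := hx.trans hzy
  rw [hxy]
  exact ⟨hy0, hy1⟩

end Setting

end Summit.ABC.IUTFork.Cor312Vol

end
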